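import Literature.NumberTheory.Sieve.FordAsymptoticSieve
import Literature.NumberTheory.LFunctions.PrimeNumberTheoremErrorTermProofs
import Mathlib.NumberTheory.Chebyshev
import Mathlib.Analysis.SpecialFunctions.Pow.Real
import HarnessLib

/-!
# Ford's counterexamples to a fixed-level asymptotic sieve: prime sums on the logarithmic scale

Topic `Literature/NumberTheory/Sieve`, companion of `FordAsymptoticSieve.lean` (the named fact
`Literature.NumberTheory.Sieve.Ford2004_localConstruction` = [Ford2004] Theorem 3 with the choice
of `f_{1_M}` of the proof of Theorem 1). Source: K. Ford, *On Bombieri's asymptotic sieve*, Trans.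
Amer. Math. Soc. **357** (2005) 1663–1674 (arXiv math/0401215) [Ford2004], §2, Lemma 2.1
(the prime number theorem with the de la Vallée Poussin error term, "the only analytic tool we
require") and Lemma 2.2 (sums of smooth functions of `log p_i/log n` over `n = p_1⋯p_r` in a
short interval).

This file PROVES the two one-prime ingredients of Lemma 2.2 in the form used by the tree's
formalisation of Theorem 3 (interval `(y, y(1+η)]`, `η = e^{−c₁√log x}` = `Ford2004.eta c₁ x`,
logarithmic variable `t_p = log p/log x` = `Ford2004.tOf x p`, weights `t_p G(t_p)` with `G`
Lipschitz — on so short an interval no partial summation is needed):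

* `Ford2004.shortSum_est` — Lemma 2.2 for `r = 1`:
  `∑_{y < p ≤ y(1+η)} t_p G(t_p) = (yη/log x) G(log y/log x) + O((CS + K(1+C)) yη²/log x)` for
  `y ≥ x^{ε/2}`, `c₁ ≤ c√ε/4`, from `|ϑ(u) − u| ≤ C u e^{−c√log u}` (the tree's PROVED
  `Literature.NumberTheory.LFunctions.ChebyshevThetaDeLaValleePoussin_holds` supplies such
  `c, C`; here they are hypotheses so that the dependence of all constants is explicit);
* `Ford2004.longSum_est` — the partial-summation step of the induction in Lemma 2.2:
  `∑_{p ≤ x²} (t_p/p) F(t_p) = ∫ F + O((A₁ S + A₂ K) η)` for `F` `K`-Lipschitz, bounded by `S`,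
  living on `[ε, 2]`; proved WITHOUT Mertens' theorems by cutting `(x^{ε/2}, x²]` into the
  `≤ 5 log x/η` multiplicative cells `(u_i, u_i(1+η)]`, applying `shortSum_est` on each and
  comparing the Riemann sum of step `log(1+η)/log x` with the integral
  (`norm_riemannSum_sub_integral_le`);
* bookkeeping: `primesIn`, `theta_sub_theta_eq_sum`, `card_primesIn_window_le`
  (`#{y < p ≤ y(1+η)} ≤ (1+3C) yη/log y`), `grid_bounds`, `sum_eq_sum_cells`.

Everything here is a theorem (plus the notations `tOf`, `primesIn`, `A₁`, `A₂`); no named facts.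
The `r`-fold statement of Lemma 2.2 is `Ford2004.primeSum_est` in
`FordAsymptoticSieveLemma22.lean`.

## References

* K. Ford, *On Bombieri's asymptotic sieve*, Trans. AMS 357 (2005), 1663–1674, §2, Lemmas 2.1–2.2
  [Ford2004].
* H. L. Montgomery, R. C. Vaughan, *Multiplicative Number Theory I*, CUP 2007, Thm 6.9 (the error
  term `x e^{−c√log x}`) [MontgomeryVaughan2007].
-/

noncomputable section

open Finset Real MeasureTheory
open scoped Chebyshev

namespace Literature.NumberTheory.Sieve.Ford2004

/-! ### Notation -/

/-- The logarithmic size `t_p = log p / log x` of an integer relative to `x`. [cite: Ford2004, §2] -/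
def tOf (x : ℝ) (p : ℕ) : ℝ := Real.log p / Real.log x

/-- The primes in `(a, b]`. [folklore] -/
def primesIn (a b : ℕ) : Finset ℕ := (Finset.Ioc a b).filter Nat.Prime

/-- `mem_primesIn`: auxiliary (unfolding / closure / size lemma). [folklore] -/
theorem mem_primesIn {a b p : ℕ} : p ∈ primesIn a b ↔ p.Prime ∧ a < p ∧ p ≤ b := by
  simp [primesIn, and_comm, and_assoc]

/-- Membership in `primesIn ⌊y⌋ ⌊y'⌋` in real terms: `y < p ≤ y'`. [folklore] -/
theorem mem_primesIn_floor {y y' : ℝ} (hy : 0 ≤ y) {p : ℕ} :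
    p ∈ primesIn ⌊y⌋₊ ⌊y'⌋₊ ↔ p.Prime ∧ y < p ∧ (p : ℝ) ≤ y' := by
  rw [mem_primesIn]
  constructor
  · rintro ⟨hp, h1, h2⟩
    exact ⟨hp, (Nat.floor_lt hy).mp h1, (Nat.le_floor_iff' hp.ne_zero).mp h2⟩
  · rintro ⟨hp, h1, h2⟩
    exact ⟨hp, (Nat.floor_lt hy).mpr h1, (Nat.le_floor_iff' hp.ne_zero).mpr h2⟩

/-- `ϑ(y') − ϑ(y) = ∑_{y < p ≤ y'} log p`. [folklore] -/
theorem theta_sub_theta_eq_sum {y y' : ℝ} (hyy : y ≤ y') :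
    θ y' - θ y = ∑ p ∈ primesIn ⌊y⌋₊ ⌊y'⌋₊, Real.log p := by
  have hfl : ⌊y⌋₊ ≤ ⌊y'⌋₊ := Nat.floor_le_floor hyy
  rw [Chebyshev.theta, Chebyshev.theta, primesIn, sub_eq_iff_eq_add', ← Finset.sum_union]
  · congr 1
    rw [← Finset.filter_union, Finset.Ioc_union_Ioc_eq_Ioc (Nat.zero_le _) hfl]
  · exact Finset.disjoint_filter_filter (Finset.Ioc_disjoint_Ioc_of_le le_rfl)

/-- The prime number theorem in the short-interval form used here: for `2 ≤ y ≤ y'`,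
`|ϑ(y') − ϑ(y) − (y' − y)| ≤ C (y' + y) e^{−c√log y}`. [folklore] -/
theorem abs_theta_window_sub_le {c C : ℝ} (hc : 0 ≤ c)
    (hPNT : ∀ u : ℝ, 2 ≤ u → |θ u - u| ≤ C * u / Real.exp (c * Real.sqrt (Real.log u)))
    {y y' : ℝ} (hy : 2 ≤ y) (hyy : y ≤ y') :
    |θ y' - θ y - (y' - y)| ≤ C * (y' + y) * Real.exp (-(c * Real.sqrt (Real.log y))) := by
  have hC : 0 ≤ C := by
    have h := hPNT 2 le_rfl
    have h2 : (0 : ℝ) ≤ C * 2 / Real.exp (c * Real.sqrt (Real.log 2)) := (abs_nonneg _).trans h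
    have h3 : 0 < Real.exp (c * Real.sqrt (Real.log 2)) := Real.exp_pos _
    have h4 : 0 ≤ C * 2 := by
      by_contra h5
      push Not at h5
      have := div_neg_of_neg_of_pos h5 h3
      linarith
    linarith
  have h1 := hPNT y hy
  have h2 := hPNT y' (hy.trans hyy)
  have hmono : Real.exp (c * Real.sqrt (Real.log y)) ≤ Real.exp (c * Real.sqrt (Real.log y')) := by
    apply Real.exp_le_exp.mpr
    exact mul_le_mul_of_nonneg_left (Real.sqrt_le_sqrt (Real.log_le_log (by linarith) hyy)) hc
  have hE : 0 < Real.exp (c * Real.sqrt (Real.log y)) := Real.exp_pos _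
  have h2' : |θ y' - y'| ≤ C * y' / Real.exp (c * Real.sqrt (Real.log y)) := by
    refine h2.trans ?_
    rw [div_le_div_iff₀ (Real.exp_pos _) hE]
    have : 0 ≤ C * y' := mul_nonneg hC (by linarith)
    nlinarith
  rw [Real.exp_neg]
  calc |θ y' - θ y - (y' - y)| = |(θ y' - y') - (θ y - y)| := by ring_nf
    _ ≤ |θ y' - y'| + |θ y - y| := abs_sub _ _
    _ ≤ C * y' / Real.exp (c * Real.sqrt (Real.log y)) + C * y / Real.exp (c * Real.sqrt (Real.log y)) :=
        add_le_add h2' h1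
    _ = C * (y' + y) * (Real.exp (c * Real.sqrt (Real.log y)))⁻¹ := by ring

/-- The basic comparison of scales: for `y ≥ x^{ε/2}` and `c₁ ≤ c √ε / 4`,
`e^{−c √log y} ≤ η_{c₁}(x)^2`. [folklore] -/
theorem exp_neg_sqrt_log_le_eta_sq {c c₁ ε x y : ℝ} (hc : 0 ≤ c) (hε : 0 < ε) (hc₁ : c₁ ≤ c * Real.sqrt ε / 4)
    (hx : 1 ≤ x) (hy : x ^ (ε / 2) ≤ y) :
    Real.exp (-(c * Real.sqrt (Real.log y))) ≤ eta c₁ x ^ 2 := by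
  rw [eta, ← Real.exp_nat_mul, Real.exp_le_exp]
  push_cast
  have hx0 : 0 < x := by linarith
  have hL : 0 ≤ Real.log x := Real.log_nonneg hx
  have hy0 : 0 < y := lt_of_lt_of_le (Real.rpow_pos_of_pos hx0 _) hy
  have hlogy : ε / 2 * Real.log x ≤ Real.log y := by
    have := Real.log_le_log (Real.rpow_pos_of_pos hx0 _) hy
    rwa [Real.log_rpow hx0] at this
  -- `2 c₁ √L ≤ c √(log y)`
  have h1 : Real.sqrt (ε / 2 * Real.log x) ≤ Real.sqrt (Real.log y) := Real.sqrt_le_sqrt hlogy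
  have h2 : Real.sqrt (ε / 2 * Real.log x) = Real.sqrt (ε / 2) * Real.sqrt (Real.log x) :=
    Real.sqrt_mul (by linarith) _
  have h3 : Real.sqrt ε ≤ 2 * Real.sqrt (ε / 2) := by
    rw [show (2 : ℝ) * Real.sqrt (ε / 2) = Real.sqrt (2 ^ 2 * (ε / 2)) by
      rw [Real.sqrt_mul (by norm_num), Real.sqrt_sq (by norm_num)]]
    exact Real.sqrt_le_sqrt (by linarith)
  have hsq : 0 ≤ Real.sqrt (Real.log x) := Real.sqrt_nonneg _
  have hsε : 0 ≤ Real.sqrt (ε / 2) := Real.sqrt_nonneg _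
  have : 2 * (c₁ * Real.sqrt (Real.log x)) ≤ c * Real.sqrt (Real.log y) := by
    calc 2 * (c₁ * Real.sqrt (Real.log x)) ≤ 2 * ((c * Real.sqrt ε / 4) * Real.sqrt (Real.log x)) := by
          gcongr
      _ ≤ 2 * ((c * (2 * Real.sqrt (ε / 2)) / 4) * Real.sqrt (Real.log x)) := by gcongr
      _ = c * (Real.sqrt (ε / 2) * Real.sqrt (Real.log x)) := by ring
      _ = c * Real.sqrt (ε / 2 * Real.log x) := by rw [h2]
      _ ≤ c * Real.sqrt (Real.log y) := mul_le_mul_of_nonneg_left h1 hc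
  linarith

/-- `log(1 + η) ≤ η` and the window for `t_p`: for `y < p ≤ y(1+η)`,
`0 ≤ t_p − log y / log x ≤ η / log x`. [folklore] -/
theorem tOf_sub_le {x y η : ℝ} (hx : 1 < x) (hy : 0 < y) (hη : 0 ≤ η) {p : ℕ} (h1 : y < p)
    (h2 : (p : ℝ) ≤ y * (1 + η)) :
    0 ≤ tOf x p - Real.log y / Real.log x ∧ tOf x p - Real.log y / Real.log x ≤ η / Real.log x := by
  have hL : 0 < Real.log x := Real.log_pos hx
  have hp : (0 : ℝ) < p := hy.trans h1
  rw [tOf, ← sub_div]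
  constructor
  · exact div_nonneg (by linarith [Real.log_lt_log hy h1]) hL.le
  · refine div_le_div_of_nonneg_right ?_ hL.le
    have h3 : Real.log p ≤ Real.log y + Real.log (1 + η) := by
      rw [← Real.log_mul hy.ne' (by linarith)]
      exact Real.log_le_log hp h2
    have h4 : Real.log (1 + η) ≤ η := by
      have := Real.log_le_sub_one_of_pos (show 0 < 1 + η by linarith)
      linarith
    linarith

/-- **Ford's Lemma 2.2 for `r = 1`, weighted form**: for a `K`-Lipschitz weight `G` bounded by
`S`, `x` large, `c₁ ≤ c√ε/4` and `y ≥ x^{ε/2}`,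
`∑_{y < p ≤ y(1+η)} t_p G(t_p) = (yη/log x) G(log y/log x) + O((CS + K(1+C)) yη²/log x)`,
`η = e^{−c₁√log x}`, by the prime number theorem with the de la Vallée Poussin error term
(`|ϑ(u) − u| ≤ C u e^{−c√log u}`): on so short an interval the weight is constant up to
`O(Kη/log x)`. [cite: Ford2004, Lemma 2.2 (case r = 1)] -/
theorem shortSum_est {c C : ℝ} (hc : 0 < c)
    (hPNT : ∀ u : ℝ, 2 ≤ u → |θ u - u| ≤ C * u / Real.exp (c * Real.sqrt (Real.log u)))
    {ε : ℝ} (hε : 0 < ε) {x : ℝ} (hx : Real.exp 1 ≤ x) (hx2 : 2 ≤ x ^ (ε / 2))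
    {c₁ : ℝ} (hc₁ : 0 < c₁) (hc₁' : c₁ ≤ c * Real.sqrt ε / 4)
    (G : ℝ → ℂ) {S K : ℝ} (hS : ∀ t, ‖G t‖ ≤ S) (hK : ∀ t t', ‖G t - G t'‖ ≤ K * |t - t'|)
    {y : ℝ} (hy : x ^ (ε / 2) ≤ y) :
    ‖∑ p ∈ primesIn ⌊y⌋₊ ⌊y * (1 + eta c₁ x)⌋₊, (tOf x p : ℂ) * G (tOf x p) -
        ((y * eta c₁ x / Real.log x : ℝ) : ℂ) * G (Real.log y / Real.log x)‖ ≤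
      (3 * C * S + K * (1 + 3 * C)) * y * eta c₁ x ^ 2 / Real.log x := by
  -- basic positivity
  set η := eta c₁ x with hηdef
  set L := Real.log x with hLdef
  have hx1 : 1 < x := lt_of_lt_of_le (by have := Real.add_one_le_exp (1:ℝ); linarith) hx
  have hL1 : 1 ≤ L := by rw [hLdef, ← Real.log_exp 1]; exact Real.log_le_log (Real.exp_pos 1) hx
  have hL : 0 < L := by linarith
  have hη0 : 0 < η := eta_pos c₁ x
  have hη1 : η ≤ 1 := eta_le_one hc₁.le x
  have hy2 : 2 ≤ y := hx2.trans hy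
  have hy0 : 0 < y := by linarith
  set y' := y * (1 + η) with hy'def
  have hyy : y ≤ y' := by rw [hy'def]; nlinarith
  have hC : 0 ≤ C := by
    have h := (abs_nonneg _).trans (hPNT 2 le_rfl)
    have h3 : 0 < Real.exp (c * Real.sqrt (Real.log 2)) := Real.exp_pos _
    rw [le_div_iff₀ h3, zero_mul] at h
    linarith
  have hS0 : 0 ≤ S := (norm_nonneg _).trans (hS 0)
  have hK0 : 0 ≤ K := by
    have := hK 1 0
    simp only [sub_zero, abs_one, mul_one] at this
    exact (norm_nonneg _).trans this
  set Y := Real.log y / L with hYdef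
  set P := primesIn ⌊y⌋₊ ⌊y'⌋₊ with hPdef
  -- the prime number theorem on the window
  set Θ := ∑ p ∈ P, Real.log (p : ℝ) with hΘdef
  have hΘ : Θ = θ y' - θ y := (theta_sub_theta_eq_sum hyy).symm
  have hexp : Real.exp (-(c * Real.sqrt (Real.log y))) ≤ η ^ 2 :=
    exp_neg_sqrt_log_le_eta_sq hc.le hε hc₁' hx1.le hy
  have hR : |Θ - y * η| ≤ 3 * C * y * η ^ 2 := by
    have h1 := abs_theta_window_sub_le hc.le hPNT hy2 hyy
    rw [← hΘ, show y' - y = y * η by rw [hy'def]; ring] at h1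
    refine h1.trans ?_
    have h2 : y' + y ≤ 3 * y := by rw [hy'def]; nlinarith
    calc C * (y' + y) * Real.exp (-(c * Real.sqrt (Real.log y)))
        ≤ C * (3 * y) * η ^ 2 := by gcongr
      _ = 3 * C * y * η ^ 2 := by ring
  have hΘle : Θ ≤ y * η * (1 + 3 * C) := by
    have h1 : Θ ≤ y * η + 3 * C * y * η ^ 2 := by linarith [(abs_le.mp hR).2]
    have h2 : 3 * C * y * η ^ 2 ≤ 3 * C * y * η := by
      have : η ^ 2 ≤ η := by nlinarith
      have : 0 ≤ 3 * C * y := by positivity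
      nlinarith
    nlinarith
  have hΘ0 : 0 ≤ Θ := Finset.sum_nonneg fun p hp => Real.log_natCast_nonneg p
  -- membership facts
  have hmem : ∀ p ∈ P, p.Prime ∧ y < p ∧ (p : ℝ) ≤ y' := fun p hp =>
    (mem_primesIn_floor hy0.le).mp hp
  have htp : ∀ p ∈ P, 0 ≤ tOf x p ∧ |tOf x p - Y| ≤ η / L := by
    intro p hp
    obtain ⟨hp', h1, h2⟩ := hmem p hp
    have hw := tOf_sub_le hx1 hy0 hη0.le h1 h2
    refine ⟨?_, ?_⟩
    · exact div_nonneg (Real.log_natCast_nonneg p) hL.le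
    · rw [abs_of_nonneg hw.1]; exact hw.2
  -- decomposition of the difference
  have hdecomp : ∑ p ∈ P, (tOf x p : ℂ) * G (tOf x p) - ((y * η / L : ℝ) : ℂ) * G Y =
      ∑ p ∈ P, (tOf x p : ℂ) * (G (tOf x p) - G Y) + G Y * (((Θ - y * η) / L : ℝ) : ℂ) := by
    have h1 : ∑ p ∈ P, (tOf x p : ℂ) * G Y = G Y * ((Θ / L : ℝ) : ℂ) := by
      rw [hΘdef, Finset.sum_div, Complex.ofReal_sum, Finset.mul_sum]
      refine Finset.sum_congr rfl fun p _ => ?_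
      rw [tOf]; push_cast; ring
    have h2 : ∑ p ∈ P, (tOf x p : ℂ) * (G (tOf x p) - G Y) =
        ∑ p ∈ P, (tOf x p : ℂ) * G (tOf x p) - ∑ p ∈ P, (tOf x p : ℂ) * G Y := by
      rw [← Finset.sum_sub_distrib]
      refine Finset.sum_congr rfl fun p _ => by ring
    rw [h2, h1]
    push_cast
    ring
  rw [hdecomp]
  -- bound the two pieces
  have hb1 : ‖∑ p ∈ P, (tOf x p : ℂ) * (G (tOf x p) - G Y)‖ ≤ K * η / L * (Θ / L) := by
    calc ‖∑ p ∈ P, (tOf x p : ℂ) * (G (tOf x p) - G Y)‖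
        ≤ ∑ p ∈ P, ‖(tOf x p : ℂ) * (G (tOf x p) - G Y)‖ := norm_sum_le _ _
      _ ≤ ∑ p ∈ P, tOf x p * (K * (η / L)) := by
          refine Finset.sum_le_sum fun p hp => ?_
          rw [norm_mul, Complex.norm_real, Real.norm_eq_abs, abs_of_nonneg (htp p hp).1]
          refine mul_le_mul_of_nonneg_left ?_ (htp p hp).1
          exact (hK _ _).trans (mul_le_mul_of_nonneg_left (htp p hp).2 hK0)
      _ = K * η / L * (Θ / L) := by
          rw [← Finset.sum_mul, hΘdef, Finset.sum_div]
          simp only [tOf]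
          ring
  have hb2 : ‖G Y * (((Θ - y * η) / L : ℝ) : ℂ)‖ ≤ S * (3 * C * y * η ^ 2 / L) := by
    rw [norm_mul, Complex.norm_real, Real.norm_eq_abs, abs_div, abs_of_pos hL]
    exact mul_le_mul (hS Y) (div_le_div_of_nonneg_right hR hL.le) (by positivity) hS0
  calc ‖∑ p ∈ P, (tOf x p : ℂ) * (G (tOf x p) - G Y) + G Y * (((Θ - y * η) / L : ℝ) : ℂ)‖
      ≤ K * η / L * (Θ / L) + S * (3 * C * y * η ^ 2 / L) := (norm_add_le _ _).trans (add_le_add hb1 hb2)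
    _ ≤ K * η / L * (y * η * (1 + 3 * C) / L) + S * (3 * C * y * η ^ 2 / L) := by
        gcongr
    _ ≤ K * η / L * (y * η * (1 + 3 * C)) + S * (3 * C * y * η ^ 2 / L) := by
        gcongr
        · exact div_le_self (by positivity) hL1
    _ = (3 * C * S + K * (1 + 3 * C)) * y * η ^ 2 / L := by ring

/-! ### Splitting prime sums along a grid -/

/-- `sum_primesIn_split`: auxiliary (unfolding / closure / size lemma). [folklore] -/
theorem sum_primesIn_split {M : Type*} [AddCommMonoid M] (f : ℕ → M) {a b d : ℕ} (hab : a ≤ b)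
    (hbd : b ≤ d) :
    ∑ p ∈ primesIn a d, f p = ∑ p ∈ primesIn a b, f p + ∑ p ∈ primesIn b d, f p := by
  rw [primesIn, primesIn, primesIn, ← Finset.sum_union]
  · congr 1
    rw [← Finset.filter_union, Finset.Ioc_union_Ioc_eq_Ioc hab hbd]
  · exact Finset.disjoint_filter_filter (Finset.Ioc_disjoint_Ioc_of_le le_rfl)

/-- Decomposition of a prime sum along an increasing chain of cut points. [folklore] -/
theorem sum_primesIn_chain {M : Type*} [AddCommMonoid M] (f : ℕ → M) (n : ℕ → ℕ)
    (hn : Monotone n) (N : ℕ) :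
    ∑ p ∈ primesIn 0 (n N), f p =
      ∑ p ∈ primesIn 0 (n 0), f p + ∑ i ∈ range N, ∑ p ∈ primesIn (n i) (n (i + 1)), f p := by
  induction N with
  | zero => simp
  | succ N ih =>
    rw [sum_primesIn_split f (Nat.zero_le _) (hn (Nat.le_succ N)), ih, Finset.sum_range_succ,
      add_assoc]

/-! ### Counting primes in a short window -/

/-- The window sum `Θ = ∑_{y < p ≤ y(1+η)} log p` satisfies `|Θ − yη| ≤ 3C y η²` and
`Θ ≤ (1 + 3C) y η` for `y ≥ x^{ε/2}`, `c₁ ≤ c√ε/4`. [folklore] -/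
theorem theta_window_bounds {c C : ℝ} (hc : 0 < c)
    (hPNT : ∀ u : ℝ, 2 ≤ u → |θ u - u| ≤ C * u / Real.exp (c * Real.sqrt (Real.log u)))
    {ε : ℝ} (hε : 0 < ε) {x : ℝ} (hx : 1 ≤ x) (hx2 : 2 ≤ x ^ (ε / 2))
    {c₁ : ℝ} (hc₁ : 0 < c₁) (hc₁' : c₁ ≤ c * Real.sqrt ε / 4) {y : ℝ} (hy : x ^ (ε / 2) ≤ y) :
    |∑ p ∈ primesIn ⌊y⌋₊ ⌊y * (1 + eta c₁ x)⌋₊, Real.log (p : ℝ) - y * eta c₁ x| ≤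
        3 * C * y * eta c₁ x ^ 2 ∧
      ∑ p ∈ primesIn ⌊y⌋₊ ⌊y * (1 + eta c₁ x)⌋₊, Real.log (p : ℝ) ≤ (1 + 3 * C) * y * eta c₁ x := by
  set η := eta c₁ x with hηdef
  have hη0 : 0 < η := eta_pos c₁ x
  have hη1 : η ≤ 1 := eta_le_one hc₁.le x
  have hy2 : 2 ≤ y := hx2.trans hy
  have hy0 : 0 < y := by linarith
  have hyy : y ≤ y * (1 + η) := by nlinarith
  have hC : 0 ≤ C := by
    have h := (abs_nonneg _).trans (hPNT 2 le_rfl)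
    rw [le_div_iff₀ (Real.exp_pos _), zero_mul] at h
    linarith
  have hexp : Real.exp (-(c * Real.sqrt (Real.log y))) ≤ η ^ 2 :=
    exp_neg_sqrt_log_le_eta_sq hc.le hε hc₁' hx hy
  have hR : |∑ p ∈ primesIn ⌊y⌋₊ ⌊y * (1 + η)⌋₊, Real.log (p : ℝ) - y * η| ≤ 3 * C * y * η ^ 2 := by
    have h1 := abs_theta_window_sub_le hc.le hPNT hy2 hyy
    rw [theta_sub_theta_eq_sum hyy, show y * (1 + η) - y = y * η by ring] at h1
    refine h1.trans ?_
    calc C * (y * (1 + η) + y) * Real.exp (-(c * Real.sqrt (Real.log y)))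
        ≤ C * (3 * y) * η ^ 2 := by gcongr; nlinarith
      _ = 3 * C * y * η ^ 2 := by ring
  refine ⟨hR, ?_⟩
  have h1 := (abs_le.mp hR).2
  have h2 : 3 * C * y * η ^ 2 ≤ 3 * C * y * η := by
    have h3 : 0 ≤ 3 * C * y := by positivity
    have h4 : η ^ 2 ≤ η := by nlinarith
    exact mul_le_mul_of_nonneg_left h4 h3
  nlinarith

/-- The number of primes in `(y, y(1+η)]` is at most `(1 + 3C) yη / log y`. [folklore] -/
theorem card_primesIn_window_le {c C : ℝ} (hc : 0 < c)
    (hPNT : ∀ u : ℝ, 2 ≤ u → |θ u - u| ≤ C * u / Real.exp (c * Real.sqrt (Real.log u)))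
    {ε : ℝ} (hε : 0 < ε) {x : ℝ} (hx : 1 ≤ x) (hx2 : 2 ≤ x ^ (ε / 2))
    {c₁ : ℝ} (hc₁ : 0 < c₁) (hc₁' : c₁ ≤ c * Real.sqrt ε / 4) {y : ℝ} (hy : x ^ (ε / 2) ≤ y) :
    ((primesIn ⌊y⌋₊ ⌊y * (1 + eta c₁ x)⌋₊).card : ℝ) ≤ (1 + 3 * C) * y * eta c₁ x / Real.log y := by
  have hy2 : 2 ≤ y := hx2.trans hy
  have hy0 : 0 < y := by linarith
  have hlogy : 0 < Real.log y := Real.log_pos (by linarith)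
  rw [le_div_iff₀ hlogy]
  refine le_trans ?_ (theta_window_bounds hc hPNT hε hx hx2 hc₁ hc₁' hy).2
  rw [← nsmul_eq_mul, ← Finset.sum_const]
  refine Finset.sum_le_sum fun p hp => ?_
  obtain ⟨_, h1, _⟩ := (mem_primesIn_floor hy0.le).mp hp
  exact Real.log_le_log hy0 h1.le

/-! ### Riemann sums and the grid step `log(1 + η)` -/

/-- `η/2 ≤ log(1 + η) ≤ η` for `0 ≤ η ≤ 1`. [folklore] -/
theorem log_one_add_bounds {η : ℝ} (h0 : 0 ≤ η) (h1 : η ≤ 1) :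
    η / 2 ≤ Real.log (1 + η) ∧ Real.log (1 + η) ≤ η := by
  constructor
  · have := Real.one_sub_inv_le_log_of_pos (show 0 < 1 + η by linarith)
    have h2 : η / 2 ≤ 1 - (1 + η)⁻¹ := by
      rw [show 1 - (1 + η)⁻¹ = η / (1 + η) by field_simp; ring]
      exact div_le_div_of_nonneg_left h0 (by linarith) (by linarith)
    linarith
  · have := Real.log_le_sub_one_of_pos (show 0 < 1 + η by linarith)
    linarith

/-- `|η / log(1 + η) − 1| ≤ η` for `0 < η ≤ 1`. [folklore] -/
theorem abs_div_log_one_add_sub_one_le {η : ℝ} (h0 : 0 < η) (h1 : η ≤ 1) :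
    |η / Real.log (1 + η) - 1| ≤ η := by
  have hlog : 0 < Real.log (1 + η) := Real.log_pos (by linarith)
  have hup : Real.log (1 + η) ≤ η := (log_one_add_bounds h0.le h1).2
  have hlow : η / (1 + η) ≤ Real.log (1 + η) := by
    have := Real.one_sub_inv_le_log_of_pos (show 0 < 1 + η by linarith)
    rwa [show 1 - (1 + η)⁻¹ = η / (1 + η) by field_simp; ring] at this
  rw [abs_le]
  constructor
  · have : 1 ≤ η / Real.log (1 + η) := by rw [le_div_iff₀ hlog]; linarith
    linarith
  · have h2 : η ≤ (1 + η) * Real.log (1 + η) := by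
      rwa [div_le_iff₀' (by linarith : 0 < 1 + η)] at hlow
    have h3 : η / Real.log (1 + η) ≤ 1 + η := by
      rw [div_le_iff₀ hlog]; linarith
    linarith

/-- Left Riemann sums of a Lipschitz function: `‖∑_{i<N} Δ F(a + iΔ) − ∫_a^{a+NΔ} F‖ ≤ N K Δ²`.
[folklore] -/
theorem norm_riemannSum_sub_integral_le {F : ℝ → ℂ} {K : ℝ} (hF : Continuous F)
    (hK : ∀ t t', ‖F t - F t'‖ ≤ K * |t - t'|) (a : ℝ) {Δ : ℝ} (hΔ : 0 < Δ) (N : ℕ) :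
    ‖∑ i ∈ range N, (Δ : ℂ) * F (a + i * Δ) - ∫ t in a..(a + N * Δ), F t‖ ≤ N * K * Δ ^ 2 := by
  have hint : ∀ u v : ℝ, IntervalIntegrable F volume u v := fun u v =>
    hF.intervalIntegrable u v
  have key : ∑ k ∈ range N, ∫ x in (a + k * Δ)..(a + (↑(k + 1)) * Δ), F x =
      ∫ x in a..(a + N * Δ), F x := by
    have := intervalIntegral.sum_integral_adjacent_intervals (a := fun k : ℕ => a + k * Δ) (n := N)
      (fun k _ => hint _ _)
    simpa using this
  rw [← key, ← Finset.sum_sub_distrib]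
  calc ‖∑ i ∈ range N, ((Δ : ℂ) * F (a + i * Δ) - ∫ t in (a + i * Δ)..(a + (↑(i + 1)) * Δ), F t)‖
      ≤ ∑ i ∈ range N, ‖(Δ : ℂ) * F (a + i * Δ) - ∫ t in (a + i * Δ)..(a + (↑(i + 1)) * Δ), F t‖ :=
        norm_sum_le _ _
    _ ≤ ∑ i ∈ range N, K * Δ ^ 2 := by
        refine Finset.sum_le_sum fun i _ => ?_
        have hend : a + ((i + 1 : ℕ) : ℝ) * Δ = a + i * Δ + Δ := by push_cast; ring
        rw [hend]
        have hconst : (Δ : ℂ) * F (a + i * Δ) = ∫ _ in (a + i * Δ)..(a + i * Δ + Δ), F (a + i * Δ) := by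
          rw [intervalIntegral.integral_const]
          simp
        rw [hconst, ← intervalIntegral.integral_sub intervalIntegrable_const (hint _ _)]
        have hb : ∀ t ∈ Set.uIoc (a + i * Δ) (a + i * Δ + Δ), ‖F (a + i * Δ) - F t‖ ≤ K * Δ := by
          intro t ht
          rw [Set.uIoc_of_le (by linarith)] at ht
          refine (hK _ _).trans (mul_le_mul_of_nonneg_left ?_ ?_)
          · rw [abs_le]; constructor <;> linarith [ht.1, ht.2]
          · have := hK 1 0
            simp only [sub_zero, abs_one, mul_one] at this
            exact (norm_nonneg _).trans this
        calc ‖∫ t in (a + i * Δ)..(a + i * Δ + Δ), (F (a + ↑i * Δ) - F t)‖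
              ≤ K * Δ * |a + i * Δ + Δ - (a + i * Δ)| :=
              intervalIntegral.norm_integral_le_of_norm_le_const hb
          _ = K * Δ ^ 2 := by rw [show a + i * Δ + Δ - (a + i * Δ) = Δ by ring, abs_of_pos hΔ]; ring
    _ = N * K * Δ ^ 2 := by rw [Finset.sum_const, Finset.card_range, nsmul_eq_mul]; ring

/-- A function vanishing outside `[lo, hi]`, with `a < lo`, `hi ≤ b`, `a ≤ b`, has `∫ F = ∫_a^b F`.
[folklore] -/
theorem integral_eq_intervalIntegral_of_support {F : ℝ → ℂ} {lo hi a b : ℝ}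
    (hF : ∀ t, F t ≠ 0 → lo ≤ t ∧ t ≤ hi) (ha : a < lo) (hb : hi ≤ b) (hab : a ≤ b) :
    ∫ t, F t = ∫ t in a..b, F t := by
  rw [intervalIntegral.integral_of_le hab]
  refine (setIntegral_eq_integral_of_forall_compl_eq_zero fun t ht => ?_).symm
  by_contra hne
  have := hF t hne
  exact ht ⟨by linarith [this.1], this.2.trans hb⟩

/-! ### The long-range sum `∑_p t_p F(t_p)/p` (Ford's Lemma 2.2, partial-summation step) -/

/-- Constant in front of `sup ‖F‖` in `longSum_est`. [folklore] -/
def A₁ (C ε : ℝ) : ℝ := 15 * C + 20 * (1 + 3 * C) / ε + 3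

/-- Constant in front of the Lipschitz constant of `F` in `longSum_est`. [folklore] -/
def A₂ (C : ℝ) : ℝ := 11 + 15 * C

/-- `continuous_of_lip`: auxiliary (unfolding / closure / size lemma). [folklore] -/
theorem continuous_of_lip {F : ℝ → ℂ} {K : ℝ} (hK : ∀ t t', ‖F t - F t'‖ ≤ K * |t - t'|) :
    Continuous F := by
  have hK0 : 0 ≤ K := by
    have := hK 1 0
    simp only [sub_zero, abs_one, mul_one] at this
    exact (norm_nonneg _).trans this
  refine (LipschitzWith.of_dist_le_mul (K := ⟨K, hK0⟩) fun t t' => ?_).continuous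
  rw [dist_eq_norm, Real.dist_eq]
  exact hK t t'

/-- `nonneg_of_lip`: auxiliary (unfolding / closure / size lemma). [folklore] -/
theorem nonneg_of_lip {F : ℝ → ℂ} {K : ℝ} (hK : ∀ t t', ‖F t - F t'‖ ≤ K * |t - t'|) : 0 ≤ K := by
  have := hK 1 0
  simp only [sub_zero, abs_one, mul_one] at this
  exact (norm_nonneg _).trans this

/-- `pnt_const_nonneg`: auxiliary (unfolding / closure / size lemma). [folklore] -/
theorem pnt_const_nonneg {c C : ℝ}
    (hPNT : ∀ u : ℝ, 2 ≤ u → |θ u - u| ≤ C * u / Real.exp (c * Real.sqrt (Real.log u))) : 0 ≤ C := by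
  have h := (abs_nonneg _).trans (hPNT 2 le_rfl)
  rw [le_div_iff₀ (Real.exp_pos _), zero_mul] at h
  linarith

/-- `|1/p − 1/u| ≤ η/u` for `u < p ≤ u(1+η)`. [folklore] -/
theorem abs_inv_sub_inv_le {u η : ℝ} (hu : 0 < u) (hη : 0 ≤ η) {p : ℝ} (h1 : u < p)
    (h2 : p ≤ u * (1 + η)) : |1 / p - 1 / u| ≤ η / u := by
  have hp : 0 < p := hu.trans h1
  rw [abs_sub_comm, abs_of_nonneg (by rw [sub_nonneg]; exact one_div_le_one_div_of_le hu h1.le)]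
  have h3 : 1 / (u * (1 + η)) ≤ 1 / p := one_div_le_one_div_of_le hp h2
  have h4 : 1 / u - 1 / (u * (1 + η)) = η / (u * (1 + η)) := by
    field_simp; ring
  have h5 : η / (u * (1 + η)) ≤ η / u :=
    div_le_div_of_nonneg_left hη hu (by nlinarith)
  linarith

/-- One cell of the grid: replacing `1/p` by `1/u` on `(u, u(1+η)]` costs
`O((1 + 3C) S η² / (ε log x))`. [folklore] -/
theorem cell_cmp {c C : ℝ} (hc : 0 < c)
    (hPNT : ∀ u : ℝ, 2 ≤ u → |θ u - u| ≤ C * u / Real.exp (c * Real.sqrt (Real.log u)))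
    {ε : ℝ} (hε : 0 < ε) {x : ℝ} (hx : 1 < x) (hx2 : 2 ≤ x ^ (ε / 2))
    {c₁ : ℝ} (hc₁ : 0 < c₁) (hc₁' : c₁ ≤ c * Real.sqrt ε / 4)
    (F : ℝ → ℂ) {S : ℝ} (hS : ∀ t, ‖F t‖ ≤ S) (hsupp : ∀ t, F t ≠ 0 → ε ≤ t ∧ t ≤ 2)
    {u : ℝ} (hu : x ^ (ε / 2) ≤ u) :
    ‖∑ p ∈ primesIn ⌊u⌋₊ ⌊u * (1 + eta c₁ x)⌋₊, ((tOf x p / p : ℝ) : ℂ) * F (tOf x p) -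
        (∑ p ∈ primesIn ⌊u⌋₊ ⌊u * (1 + eta c₁ x)⌋₊, (tOf x p : ℂ) * F (tOf x p)) / (u : ℂ)‖ ≤
      4 * (1 + 3 * C) * S / ε * eta c₁ x ^ 2 / Real.log x := by
  set η := eta c₁ x with hηdef
  set L := Real.log x with hLdef
  have hx0 : 0 < x := by linarith
  have hL : 0 < L := Real.log_pos hx
  have hη0 : 0 < η := eta_pos c₁ x
  have hxe0 : 0 < x ^ (ε / 2) := Real.rpow_pos_of_pos hx0 _
  have hu0 : 0 < u := hxe0.trans_le hu
  have hC : 0 ≤ C := pnt_const_nonneg hPNT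
  have hS0 : 0 ≤ S := (norm_nonneg _).trans (hS 0)
  have hlogu : ε / 2 * L ≤ Real.log u := by
    have := Real.log_le_log hxe0 hu
    rwa [Real.log_rpow hx0] at this
  have hlogu0 : 0 < Real.log u := lt_of_lt_of_le (by positivity) hlogu
  set P := primesIn ⌊u⌋₊ ⌊u * (1 + η)⌋₊ with hPdef
  rw [Finset.sum_div, ← Finset.sum_sub_distrib]
  have hterm : ∀ p ∈ P, ‖((tOf x p / p : ℝ) : ℂ) * F (tOf x p) - (tOf x p : ℂ) * F (tOf x p) / (u : ℂ)‖
      ≤ 2 * S * (η / u) := by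
    intro p hp
    obtain ⟨_, h1, h2⟩ := (mem_primesIn_floor hu0.le).mp hp
    have hp0 : (0 : ℝ) < p := hu0.trans h1
    have hrew : ((tOf x p / p : ℝ) : ℂ) * F (tOf x p) - (tOf x p : ℂ) * F (tOf x p) / (u : ℂ) =
        ((tOf x p * (1 / p - 1 / u) : ℝ) : ℂ) * F (tOf x p) := by
      have hu' : (u : ℂ) ≠ 0 := by exact_mod_cast hu0.ne'
      have hp' : (p : ℂ) ≠ 0 := by exact_mod_cast hp0.ne'
      push_cast
      field_simp
    rw [hrew, norm_mul, Complex.norm_real, Real.norm_eq_abs]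
    by_cases hF0 : F (tOf x p) = 0
    · rw [hF0, norm_zero, mul_zero]; positivity
    · obtain ⟨ht1, ht2⟩ := hsupp _ hF0
      have ht0 : 0 ≤ tOf x p := by linarith
      have hinv : |1 / (p : ℝ) - 1 / u| ≤ η / u := abs_inv_sub_inv_le hu0 hη0.le h1 h2
      rw [abs_mul, abs_of_nonneg ht0]
      calc tOf x p * |1 / (p : ℝ) - 1 / u| * ‖F (tOf x p)‖ ≤ 2 * (η / u) * S :=
            mul_le_mul (mul_le_mul ht2 hinv (abs_nonneg _) (by norm_num)) (hS _) (norm_nonneg _)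
              (mul_nonneg (by norm_num) (div_nonneg hη0.le hu0.le))
        _ = 2 * S * (η / u) := by ring
  calc ‖∑ p ∈ P, (((tOf x p / p : ℝ) : ℂ) * F (tOf x p) - (tOf x p : ℂ) * F (tOf x p) / (u : ℂ))‖
      ≤ ∑ p ∈ P, ‖((tOf x p / p : ℝ) : ℂ) * F (tOf x p) - (tOf x p : ℂ) * F (tOf x p) / (u : ℂ)‖ :=
        norm_sum_le _ _
    _ ≤ ∑ p ∈ P, 2 * S * (η / u) := Finset.sum_le_sum hterm
    _ = (P.card : ℝ) * (2 * S * (η / u)) := by rw [Finset.sum_const, nsmul_eq_mul]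
    _ ≤ (1 + 3 * C) * u * η / Real.log u * (2 * S * (η / u)) := by
        gcongr
        exact card_primesIn_window_le hc hPNT hε hx.le hx2 hc₁ hc₁' hu
    _ = 2 * (1 + 3 * C) * S * η ^ 2 / Real.log u := by field_simp
    _ ≤ 2 * (1 + 3 * C) * S * η ^ 2 / (ε / 2 * L) :=
        div_le_div_of_nonneg_left (by positivity) (by positivity) hlogu
    _ = 4 * (1 + 3 * C) * S / ε * η ^ 2 / L := by field_simp; ring

/-- One cell of the grid, final form: `∑_{u < p ≤ u(1+η)} (t_p/p) F(t_p) = (η/log x) F(log u/log x)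
+ O((C₁ + 4(1+3C)S/ε) η²/log x)`. [folklore] -/
theorem cell_est {c C : ℝ} (hc : 0 < c)
    (hPNT : ∀ u : ℝ, 2 ≤ u → |θ u - u| ≤ C * u / Real.exp (c * Real.sqrt (Real.log u)))
    {ε : ℝ} (hε : 0 < ε) {x : ℝ} (hx : Real.exp 1 ≤ x) (hx2 : 2 ≤ x ^ (ε / 2))
    {c₁ : ℝ} (hc₁ : 0 < c₁) (hc₁' : c₁ ≤ c * Real.sqrt ε / 4)
    (F : ℝ → ℂ) {S K : ℝ} (hS : ∀ t, ‖F t‖ ≤ S) (hK : ∀ t t', ‖F t - F t'‖ ≤ K * |t - t'|)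
    (hsupp : ∀ t, F t ≠ 0 → ε ≤ t ∧ t ≤ 2) {u : ℝ} (hu : x ^ (ε / 2) ≤ u) :
    ‖∑ p ∈ primesIn ⌊u⌋₊ ⌊u * (1 + eta c₁ x)⌋₊, ((tOf x p / p : ℝ) : ℂ) * F (tOf x p) -
        ((eta c₁ x / Real.log x : ℝ) : ℂ) * F (Real.log u / Real.log x)‖ ≤
      (3 * C * S + K * (1 + 3 * C) + 4 * (1 + 3 * C) * S / ε) * eta c₁ x ^ 2 / Real.log x := by
  set η := eta c₁ x with hηdef
  set L := Real.log x with hLdef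
  have hx1 : 1 < x := lt_of_lt_of_le (by have := Real.add_one_le_exp (1:ℝ); linarith) hx
  have hx0 : 0 < x := by linarith
  have hxe0 : 0 < x ^ (ε / 2) := Real.rpow_pos_of_pos hx0 _
  have hu0 : 0 < u := hxe0.trans_le hu
  set P := primesIn ⌊u⌋₊ ⌊u * (1 + η)⌋₊ with hPdef
  have hshort := shortSum_est hc hPNT hε hx hx2 hc₁ hc₁' F hS hK hu
  have hcmp := cell_cmp hc hPNT hε hx1 hx2 hc₁ hc₁' F hS hsupp hu
  have hdiv : ‖(∑ p ∈ P, (tOf x p : ℂ) * F (tOf x p)) / (u : ℂ) -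
      ((η / L : ℝ) : ℂ) * F (Real.log u / L)‖ ≤ (3 * C * S + K * (1 + 3 * C)) * η ^ 2 / L := by
    have hu' : (u : ℂ) ≠ 0 := by exact_mod_cast hu0.ne'
    have hrew : (∑ p ∈ P, (tOf x p : ℂ) * F (tOf x p)) / (u : ℂ) - ((η / L : ℝ) : ℂ) * F (Real.log u / L) =
        (∑ p ∈ P, (tOf x p : ℂ) * F (tOf x p) - ((u * η / L : ℝ) : ℂ) * F (Real.log u / L)) / (u : ℂ) := by
      push_cast
      field_simp
    rw [hrew, norm_div, Complex.norm_real, Real.norm_eq_abs, abs_of_pos hu0, div_le_iff₀ hu0]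
    refine hshort.trans (le_of_eq ?_)
    ring
  calc ‖∑ p ∈ P, ((tOf x p / p : ℝ) : ℂ) * F (tOf x p) - ((η / L : ℝ) : ℂ) * F (Real.log u / L)‖
      ≤ ‖∑ p ∈ P, ((tOf x p / p : ℝ) : ℂ) * F (tOf x p) - (∑ p ∈ P, (tOf x p : ℂ) * F (tOf x p)) / (u : ℂ)‖
        + ‖(∑ p ∈ P, (tOf x p : ℂ) * F (tOf x p)) / (u : ℂ) - ((η / L : ℝ) : ℂ) * F (Real.log u / L)‖ :=
        norm_sub_le_norm_sub_add_norm_sub _ _ _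
    _ ≤ 4 * (1 + 3 * C) * S / ε * η ^ 2 / L + (3 * C * S + K * (1 + 3 * C)) * η ^ 2 / L :=
        add_le_add hcmp hdiv
    _ = (3 * C * S + K * (1 + 3 * C) + 4 * (1 + 3 * C) * S / ε) * η ^ 2 / L := by ring

/-- Bookkeeping for the grid `u_i = x^{ε/2} (1+η)^i`, `0 ≤ i ≤ N`, `N = ⌈(2 − ε/2) log x / log(1+η)⌉`:
with `Δ = log(1+η)/log x` one has `2 − ε/2 ≤ NΔ ≤ 3` and `N ≤ 5 log x / η`. [folklore] -/
theorem grid_bounds {ε L η : ℝ} (hε : 0 < ε) (hε1 : ε ≤ 1) (hL : 1 ≤ L) (hη0 : 0 < η) (hη1 : η ≤ 1) :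
    let Δ := Real.log (1 + η) / L
    let N := ⌈(2 - ε / 2) / Δ⌉₊
    0 < Δ ∧ Δ ≤ η / L ∧ 2 - ε / 2 ≤ N * Δ ∧ N * Δ ≤ 3 ∧ (N : ℝ) ≤ 5 * L / η := by
  intro Δ N
  have hlog1 := log_one_add_bounds hη0.le hη1
  have hlogη : 0 < Real.log (1 + η) := by linarith [hlog1.1]
  have hL0 : 0 < L := by linarith
  have hΔ0 : 0 < Δ := div_pos hlogη hL0
  have hΔη : Δ ≤ η / L := div_le_div_of_nonneg_right hlog1.2 hL0.le
  have harg : 0 ≤ (2 - ε / 2) / Δ := div_nonneg (by linarith) hΔ0.le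
  have hNΔ : 2 - ε / 2 ≤ N * Δ := by
    have := Nat.le_ceil ((2 - ε / 2) / Δ)
    rwa [div_le_iff₀ hΔ0] at this
  have h1 := Nat.ceil_lt_add_one harg
  have hNΔ' : N * Δ ≤ 3 := by
    have h2 : (N : ℝ) * Δ < ((2 - ε / 2) / Δ + 1) * Δ := mul_lt_mul_of_pos_right h1 hΔ0
    rw [add_mul, div_mul_cancel₀ _ hΔ0.ne', one_mul] at h2
    have : Δ ≤ 1 := hΔη.trans ((div_le_self hη0.le hL).trans hη1)
    linarith
  have hN : (N : ℝ) ≤ 5 * L / η := by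
    have h2 : (2 - ε / 2) / Δ ≤ 2 / Δ := div_le_div_of_nonneg_right (by linarith) hΔ0.le
    have h3 : 2 / Δ ≤ 4 * L / η := by
      change 2 / (Real.log (1 + η) / L) ≤ 4 * L / η
      rw [div_div_eq_mul_div, div_le_div_iff₀ hlogη hη0]
      nlinarith [hlog1.1]
    have h4 : 1 ≤ L / η := by rw [le_div_iff₀ hη0]; nlinarith
    calc (N : ℝ) ≤ (2 - ε / 2) / Δ + 1 := h1.le
      _ ≤ 4 * L / η + L / η := by linarith
      _ = 5 * L / η := by ring
  exact ⟨hΔ0, hΔη, hNΔ, hNΔ', hN⟩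

/-- Steps A–B of the long-sum estimate: the sum over `p ≤ x²` equals the sum of the `N` grid
cells (the summand vanishes for `p ≤ x^{ε/2}` and for `p > x²`). [folklore] -/
theorem sum_eq_sum_cells {M : Type*} [AddCommMonoid M] {ε x η : ℝ} (hx : 1 < x) (hη : 0 ≤ η)
    (f : ℕ → M)
    (hsmall : ∀ p : ℕ, p.Prime → (p : ℝ) ≤ x ^ (ε / 2) → f p = 0)
    (hlarge : ∀ p : ℕ, x ^ 2 < p → f p = 0) {N : ℕ}
    (hN : x ^ 2 ≤ x ^ (ε / 2) * (1 + η) ^ N) :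
    ∑ p ∈ primesIn 0 ⌊x ^ 2⌋₊, f p =
      ∑ i ∈ range N, ∑ p ∈ primesIn ⌊x ^ (ε / 2) * (1 + η) ^ i⌋₊
        ⌊x ^ (ε / 2) * (1 + η) ^ i * (1 + η)⌋₊, f p := by
  have hx0 : 0 < x := by linarith
  set u : ℕ → ℝ := fun i => x ^ (ε / 2) * (1 + η) ^ i with hudef
  have hxe0 : 0 < x ^ (ε / 2) := Real.rpow_pos_of_pos hx0 _
  have humono : Monotone u := by
    refine monotone_nat_of_le_succ fun i => ?_
    simp only [hudef, pow_succ]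
    have : 0 < x ^ (ε / 2) * (1 + η) ^ i := mul_pos hxe0 (pow_pos (by linarith) i)
    nlinarith
  set n : ℕ → ℕ := fun i => ⌊u i⌋₊ with hndef
  have hnmono : Monotone n := fun i j hij => Nat.floor_le_floor (humono hij)
  -- Step A
  have hA : ∑ p ∈ primesIn 0 ⌊x ^ 2⌋₊, f p = ∑ p ∈ primesIn 0 (n N), f p := by
    rw [sum_primesIn_split f (Nat.zero_le _) (Nat.floor_le_floor hN)]
    rw [Finset.sum_eq_zero (s := primesIn ⌊x ^ 2⌋₊ (n N)) fun p hp => ?_, add_zero]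
    obtain ⟨_, h1, _⟩ := mem_primesIn.mp hp
    exact hlarge p ((Nat.floor_lt (pow_pos hx0 2).le).mp h1)
  -- Step B
  rw [hA, sum_primesIn_chain f n hnmono N]
  rw [Finset.sum_eq_zero (s := primesIn 0 (n 0)) fun p hp => ?_, zero_add]
  · refine Finset.sum_congr rfl fun i _ => ?_
    simp only [hndef, hudef, pow_succ, mul_assoc]
  · obtain ⟨hp, _, h2⟩ := mem_primesIn.mp hp
    refine hsmall p hp ?_
    have : (p : ℝ) ≤ u 0 := (Nat.le_floor_iff' hp.ne_zero).mp h2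
    simpa [hudef] using this

/-- **The long-range prime sum** ([Ford2004] Lemma 2.2, the step "by Lemma 2.1 and partial
summation"): for a `K`-Lipschitz weight `F` bounded by `S` and vanishing outside `[ε, 2]`,
`∑_{p ≤ x²} (t_p/p) F(t_p) = ∫ F(t) dt + O((A₁ S + A₂ K) η)`, `t_p = log p/log x`,
`η = e^{−c₁√log x}`, `c₁ ≤ c√ε/4`. Proof: cut `(x^{ε/2}, x²]` into the multiplicative cells
`(u_i, u_i(1+η)]`, apply the short-interval estimate `shortSum_est` on each (there are
`≤ 5 log x/η` cells), and compare the resulting Riemann sum of step `log(1+η)/log x` with the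
integral. [cite: Ford2004, Lemma 2.2] -/
theorem longSum_est {c C : ℝ} (hc : 0 < c)
    (hPNT : ∀ u : ℝ, 2 ≤ u → |θ u - u| ≤ C * u / Real.exp (c * Real.sqrt (Real.log u)))
    {ε : ℝ} (hε : 0 < ε) (hε1 : ε ≤ 1) {x : ℝ} (hx : Real.exp 1 ≤ x) (hx2 : 2 ≤ x ^ (ε / 2))
    {c₁ : ℝ} (hc₁ : 0 < c₁) (hc₁' : c₁ ≤ c * Real.sqrt ε / 4)
    (F : ℝ → ℂ) {S K : ℝ} (hS : ∀ t, ‖F t‖ ≤ S) (hK : ∀ t t', ‖F t - F t'‖ ≤ K * |t - t'|)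
    (hsupp : ∀ t, F t ≠ 0 → ε ≤ t ∧ t ≤ 2) :
    ‖∑ p ∈ primesIn 0 ⌊x ^ 2⌋₊, ((tOf x p / p : ℝ) : ℂ) * F (tOf x p) - ∫ t, F t‖ ≤
      (A₁ C ε * S + A₂ C * K) * eta c₁ x := by
  -- basic quantities
  set η := eta c₁ x with hηdef
  set L := Real.log x with hLdef
  have hx1 : 1 < x := lt_of_lt_of_le (by have := Real.add_one_le_exp (1:ℝ); linarith) hx
  have hx0 : 0 < x := by linarith
  have hL1 : 1 ≤ L := by rw [hLdef, ← Real.log_exp 1]; exact Real.log_le_log (Real.exp_pos 1) hx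
  have hL : 0 < L := by linarith
  have hη0 : 0 < η := eta_pos c₁ x
  have hη1 : η ≤ 1 := eta_le_one hc₁.le x
  have hC : 0 ≤ C := pnt_const_nonneg hPNT
  have hS0 : 0 ≤ S := (norm_nonneg _).trans (hS 0)
  have hK0 : 0 ≤ K := nonneg_of_lip hK
  have hFc : Continuous F := continuous_of_lip hK
  -- the grid
  obtain ⟨hΔ0, hΔη, hNΔ, hNΔ', hN⟩ := grid_bounds hε hε1 hL1 hη0 hη1
  set Δ := Real.log (1 + η) / L with hΔdef
  set N := ⌈(2 - ε / 2) / Δ⌉₊ with hNdef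
  have hΔη' : Δ ≤ η := hΔη.trans (div_le_self hη0.le hL1)
  have hxe0 : 0 < x ^ (ε / 2) := Real.rpow_pos_of_pos hx0 _
  set u : ℕ → ℝ := fun i => x ^ (ε / 2) * (1 + η) ^ i with hudef
  have hu0 : ∀ i, 0 < u i := fun i => mul_pos hxe0 (pow_pos (by linarith) i)
  have huge : ∀ i, x ^ (ε / 2) ≤ u i := fun i =>
    le_mul_of_one_le_right hxe0.le (one_le_pow₀ (by linarith))
  have hlogu : ∀ i, Real.log (u i) / L = ε / 2 + i * Δ := by
    intro i
    have : Real.log (u i) = ε / 2 * L + i * Real.log (1 + η) := by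
      simp only [hudef]
      rw [Real.log_mul hxe0.ne' (pow_pos (by linarith) i).ne', Real.log_rpow hx0, Real.log_pow]
    rw [this, hΔdef]
    field_simp
  -- the summand and its vanishing
  set f : ℕ → ℂ := fun p => ((tOf x p / p : ℝ) : ℂ) * F (tOf x p) with hfdef
  have hf_zero_small : ∀ p : ℕ, p.Prime → (p : ℝ) ≤ x ^ (ε / 2) → f p = 0 := by
    intro p hp hpx
    have hp0 : (0 : ℝ) < p := by exact_mod_cast hp.pos
    have ht : tOf x p ≤ ε / 2 := by
      rw [tOf, div_le_iff₀ hL]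
      have := Real.log_le_log hp0 hpx
      rwa [Real.log_rpow hx0] at this
    have hF0 : F (tOf x p) = 0 := by
      by_contra hne
      have := (hsupp _ hne).1
      linarith
    simp [hfdef, hF0]
  have hf_zero_large : ∀ p : ℕ, x ^ 2 < p → f p = 0 := by
    intro p hpx
    have hp0 : (0 : ℝ) < p := (pow_pos hx0 2).trans hpx
    have ht : 2 < tOf x p := by
      rw [tOf, lt_div_iff₀ hL]
      have := Real.log_lt_log (pow_pos hx0 2) hpx
      rwa [Real.log_pow, Nat.cast_ofNat] at this
    have hF0 : F (tOf x p) = 0 := by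
      by_contra hne
      have := (hsupp _ hne).2
      linarith
    simp [hfdef, hF0]
  have hxN : x ^ 2 ≤ u N := by
    have h1 : Real.log (x ^ 2) ≤ Real.log (u N) := by
      rw [Real.log_pow, Nat.cast_ofNat, show Real.log (u N) = L * (ε / 2 + N * Δ) by
        rw [← hlogu N]; field_simp]
      nlinarith
    exact (Real.log_le_log_iff (pow_pos hx0 2) (hu0 N)).mp h1
  have hAB := sum_eq_sum_cells hx1 hη0.le f hf_zero_small hf_zero_large hxN
  -- Step C–D: cells
  set C₂ : ℝ := 3 * C * S + K * (1 + 3 * C) + 4 * (1 + 3 * C) * S / ε with hC₂def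
  have hcell : ∀ i, ‖∑ p ∈ primesIn ⌊u i⌋₊ ⌊u i * (1 + η)⌋₊, f p -
      ((η / L : ℝ) : ℂ) * F (ε / 2 + i * Δ)‖ ≤ C₂ * η ^ 2 / L := by
    intro i
    rw [← hlogu i]
    exact cell_est hc hPNT hε hx hx2 hc₁ hc₁' F hS hK hsupp (huge i)
  have hD : ‖∑ i ∈ range N, ∑ p ∈ primesIn ⌊u i⌋₊ ⌊u i * (1 + η)⌋₊, f p -
      ∑ i ∈ range N, ((η / L : ℝ) : ℂ) * F (ε / 2 + i * Δ)‖ ≤ 5 * C₂ * η := by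
    rw [← Finset.sum_sub_distrib]
    refine (norm_sum_le _ _).trans ?_
    refine (Finset.sum_le_sum fun i _ => hcell i).trans ?_
    rw [Finset.sum_const, Finset.card_range, nsmul_eq_mul]
    calc (N : ℝ) * (C₂ * η ^ 2 / L) ≤ 5 * L / η * (C₂ * η ^ 2 / L) := by gcongr
      _ = 5 * C₂ * η := by field_simp
  -- Step E: the Riemann sum
  have hint_eq : ∫ t, F t = ∫ t in (ε / 2)..(ε / 2 + N * Δ), F t :=
    integral_eq_intervalIntegral_of_support hsupp (by linarith) (by linarith) (by nlinarith)
  have hE : ‖∑ i ∈ range N, (Δ : ℂ) * F (ε / 2 + i * Δ) - ∫ t, F t‖ ≤ 3 * K * η := by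
    rw [hint_eq]
    refine (norm_riemannSum_sub_integral_le hFc hK (ε / 2) hΔ0 N).trans ?_
    calc (N : ℝ) * K * Δ ^ 2 = K * Δ * (N * Δ) := by ring
      _ ≤ K * η * 3 := by gcongr
      _ = 3 * K * η := by ring
  have hintF : ‖∫ t, F t‖ ≤ 3 * S := by
    rw [hint_eq]
    have hb : ∀ t ∈ Set.uIoc (ε / 2) (ε / 2 + N * Δ), ‖F t‖ ≤ S := fun t _ => hS t
    refine (intervalIntegral.norm_integral_le_of_norm_le_const hb).trans ?_
    rw [show ε / 2 + N * Δ - ε / 2 = N * Δ by ring, abs_of_nonneg (by positivity)]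
    nlinarith
  -- Step F: the factor `q = η / log(1+η)`
  set q : ℝ := η / Real.log (1 + η) with hqdef
  have hq1 : |q - 1| ≤ η := abs_div_log_one_add_sub_one_le hη0 hη1
  have hq2 : |q| ≤ 2 := by
    have : |q| ≤ |q - 1| + |(1 : ℝ)| := by
      calc |q| = |q - 1 + 1| := by ring_nf
        _ ≤ |q - 1| + |(1 : ℝ)| := abs_add_le _ _
    rw [abs_one] at this
    linarith
  have hlogη : Real.log (1 + η) ≠ 0 := by
    have := (log_one_add_bounds hη0.le hη1).1; linarith
  have hqΔ : ((η / L : ℝ) : ℂ) = (q : ℂ) * (Δ : ℂ) := by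
    have : η / L = q * Δ := by rw [hqdef, hΔdef]; field_simp
    rw [this]; push_cast; ring
  have hF' : ‖∑ i ∈ range N, ((η / L : ℝ) : ℂ) * F (ε / 2 + i * Δ) - ∫ t, F t‖ ≤ (6 * K + 3 * S) * η := by
    have hrew : ∑ i ∈ range N, ((η / L : ℝ) : ℂ) * F (ε / 2 + i * Δ) - ∫ t, F t =
        (q : ℂ) * (∑ i ∈ range N, (Δ : ℂ) * F (ε / 2 + i * Δ) - ∫ t, F t) +
          ((q - 1 : ℝ) : ℂ) * ∫ t, F t := by
      rw [hqΔ]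
      have h1 : ∑ i ∈ range N, (q : ℂ) * (Δ : ℂ) * F (ε / 2 + i * Δ) =
          (q : ℂ) * ∑ i ∈ range N, (Δ : ℂ) * F (ε / 2 + i * Δ) := by
        rw [Finset.mul_sum]
        exact Finset.sum_congr rfl fun i _ => by ring
      rw [h1]
      push_cast
      ring
    rw [hrew]
    refine (norm_add_le _ _).trans ?_
    rw [norm_mul, norm_mul, Complex.norm_real, Complex.norm_real, Real.norm_eq_abs, Real.norm_eq_abs]
    calc |q| * ‖∑ i ∈ range N, (Δ : ℂ) * F (ε / 2 + i * Δ) - ∫ t, F t‖ + |q - 1| * ‖∫ t, F t‖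
        ≤ 2 * (3 * K * η) + η * (3 * S) :=
          add_le_add (mul_le_mul hq2 hE (norm_nonneg _) (by norm_num))
            (mul_le_mul hq1 hintF (norm_nonneg _) hη0.le)
      _ = (6 * K + 3 * S) * η := by ring
  -- assemble
  change ‖∑ p ∈ primesIn 0 ⌊x ^ 2⌋₊, f p - ∫ t, F t‖ ≤ (A₁ C ε * S + A₂ C * K) * η
  rw [hAB]
  calc ‖∑ i ∈ range N, ∑ p ∈ primesIn ⌊u i⌋₊ ⌊u i * (1 + η)⌋₊, f p - ∫ t, F t‖
      ≤ ‖∑ i ∈ range N, ∑ p ∈ primesIn ⌊u i⌋₊ ⌊u i * (1 + η)⌋₊, f p -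
            ∑ i ∈ range N, ((η / L : ℝ) : ℂ) * F (ε / 2 + i * Δ)‖ +
          ‖∑ i ∈ range N, ((η / L : ℝ) : ℂ) * F (ε / 2 + i * Δ) - ∫ t, F t‖ :=
        norm_sub_le_norm_sub_add_norm_sub _ _ _
    _ ≤ 5 * C₂ * η + (6 * K + 3 * S) * η := add_le_add hD hF'
    _ = (A₁ C ε * S + A₂ C * K) * η := by rw [hC₂def, A₁, A₂]; ring

end Literature.NumberTheory.Sieve.Ford2004
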